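import Mathlib.RingTheory.RegularLocalRing.Defs
import Mathlib.RingTheory.KrullDimension.NonZeroDivisors
import Mathlib.RingTheory.Nakayama

/-!
# K5-BMY — inertia of fat touches, ring form (kernel proof)

Crux `Summit.ResolutionOfSingularities.ResolutionOfSingularities.Theorems.EquisingularLiftNat`
(stmt-ResolutionOfSingularities-20038), negation side at `n = 5` (K5-BMY), branch `r = 3`
(«fat touch», the hypothesis slot `hT` of
`…Cruxes.EquisingularLiftNat.Sections.K5BMY.not_ultFlatBody_of_touchSplit`).

This file proves the ring-level statement `FatTouchInert` proposed by the strategist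
(res-L1-w45b-strat-1, STRATEGY-CENSUS-v3 §2, `Sketch-aniso.lean`; OURS, by hand there —
kernel-checked here), with its definitions unfolded:

* `R` a Noetherian local ring of Krull dimension `4` (the ambient local ring at the point over
  `η_S`), `P` a prime with `dim R ⧸ P = 2` and `R ⧸ P` **not** regular (the `H`-germ),
  `ϖ ∈ P` (the uniformiser), `(a, b)` with `R ⧸ (a, b)` regular of dimension `2`
  (a relative-dimension-`3` regular centre through the point), and E1 in the form
  `P ≤ √(a, b, ϖ)`;
* anisotropy of the tangent cone, clause (a): `P + (x)` is prime for every
  `x ∈ 𝔪 ∖ (𝔪² + P)`.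

Conclusion: the trace ideal `(ā, b̄) ⊂ R ⧸ P` is principal
(`exists_map_span_pair_eq_span_singleton`), so blowing up the centre does not change the
`H`-germ.  The proof found here is shorter than the hand proof and uses FEWER hypotheses than the
strategist's signature: the regular parameter `t ∈ P ∖ 𝔪²`, anisotropy clause (b)
(«no `F`-rational line on the cone»), regularity of `R` itself and flatness `ϖ ∉ (a, b)` are idle;
`fatTouchInert` restates the result with the strategist's full binder list for drop-in use.

Proof.  (1) `a` and `b` cannot both lie in `𝔪² + P`: otherwise the maximal ideal of `R ⧸ P` is
generated by the two remaining generators of `𝔪` modulo its square, hence (Nakayama) by two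
elements, and `dim R ⧸ P = 2` makes `R ⧸ P` regular
(`isRegularLocalRing_quotient_of_pair_mem_sq_sup`).  (2) Say `a ∉ 𝔪² + P`; then
`P₁ := P + (a)` is prime by anisotropy and `P < P₁`.  A minimal prime `Q` of `(a, b, ϖ)` has
height `≤ 3 < 4 = ht 𝔪` (Krull's height theorem), so `Q < 𝔪`, and `P + (a, b) ≤ √(a, b, ϖ) ≤ Q`
by E1.  If `b ∉ P₁` then `P < P₁ < Q < 𝔪` is a chain of primes of length `3` above `P`,
contradicting `dim R ⧸ P = 2`; hence `b ∈ P + (a)` and `(ā, b̄) = (ā)`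
(`mem_sup_span_singleton_of_radical_le`).
-/

set_option linter.dupNamespace false -- mandated namespace `Summit.<Summit>.<Problem>` of this single-conjunct summit

namespace Summit.ResolutionOfSingularities.ResolutionOfSingularities.Cruxes.EquisingularLiftNat.AnisoInertia

open IsLocalRing

variable {R : Type*} [CommRing R]

/-- Chain step.  In a Noetherian local ring of dimension `4`, let `P` be a prime with
`dim R ⧸ P = 2`, `a, b, ϖ ∈ 𝔪` with `a ∉ P`, `P ⊔ (a)` prime and `P ≤ √(a, b, ϖ)`.
Then `b ∈ P ⊔ (a)`: otherwise, with `Q < 𝔪` a minimal prime of `(a, b, ϖ)` (height `≤ 3`),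
`P < P ⊔ (a) < Q < 𝔪` would be a chain of length `3` above `P`. -/
theorem mem_sup_span_singleton_of_radical_le [IsLocalRing R] [IsNoetherianRing R]
    (hR : ringKrullDim R = 4) {P : Ideal R} [P.IsPrime] (hP : ringKrullDim (R ⧸ P) = 2)
    {a b ϖ : R} (ha : a ∈ maximalIdeal R) (hb : b ∈ maximalIdeal R) (haP : a ∉ P)
    (hPa : (P ⊔ Ideal.span {a}).IsPrime) (hϖ : ϖ ∈ maximalIdeal R)
    (hE1 : P ≤ (Ideal.span {a, b, ϖ}).radical) : b ∈ P ⊔ Ideal.span {a} := by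
  by_contra hbP
  have hle : Ideal.span {a, b, ϖ} ≤ maximalIdeal R := by
    rw [Ideal.span_le]
    rintro x (rfl | rfl | rfl) <;> assumption
  obtain ⟨Q, hQmin, hQle⟩ := Ideal.exists_minimalPrimes_le hle
  have hQprime : Q.IsPrime := hQmin.1.1
  have hIQ : Ideal.span {a, b, ϖ} ≤ Q := hQmin.1.2
  have hQht : Q.height ≤ 3 := by
    refine (Ideal.height_le_card_of_mem_minimalPrimes_span (Set.toFinite _) hQmin).trans ?_
    have h3 : ({a, b, ϖ} : Set R).ncard ≤ 3 :=
      (Set.ncard_insert_le _ _).trans (by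
        have := Set.ncard_insert_le b ({ϖ} : Set R)
        rw [Set.ncard_singleton] at this
        omega)
    exact_mod_cast h3
  have hQne : Q ≠ maximalIdeal R := by
    intro h
    have h4 := IsLocalRing.maximalIdeal_height_eq_ringKrullDim (R := R)
    rw [hR, ← h] at h4
    have h4' : Q.height = 4 := WithBot.coe_eq_coe.mp h4
    rw [h4'] at hQht
    exact absurd hQht (by norm_num)
  have hPQ : P ≤ Q := hE1.trans ((Ideal.IsPrime.radical_le_iff hQprime).mpr hIQ)
  have haQ : a ∈ Q := hIQ (Ideal.subset_span (by simp))
  have hbQ : b ∈ Q := hIQ (Ideal.subset_span (by simp))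
  have hP1Q : P ⊔ Ideal.span {a} ≤ Q :=
    sup_le hPQ ((Ideal.span_singleton_le_iff_mem _).mpr haQ)
  have h01 : P < P ⊔ Ideal.span {a} := by
    refine lt_of_le_of_ne le_sup_left (fun h => haP ?_)
    rw [h]
    exact Ideal.mem_sup_right (Ideal.mem_span_singleton_self a)
  have h12 : P ⊔ Ideal.span {a} < Q := by
    refine lt_of_le_of_ne hP1Q (fun h => hbP ?_)
    rw [h]
    exact hbQ
  have h23 : Q < maximalIdeal R := lt_of_le_of_ne hQle hQne
  -- the chain `P < P ⊔ (a) < Q < 𝔪` inside the zero locus of `P`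
  have hmem : ∀ (J : Ideal R) (hJ : J.IsPrime), P ≤ J →
      (⟨J, hJ⟩ : PrimeSpectrum R) ∈ PrimeSpectrum.zeroLocus (R := R) (P : Set R) :=
    fun J hJ h => by simpa [PrimeSpectrum.mem_zeroLocus] using h
  let Z := PrimeSpectrum.zeroLocus (R := R) (P : Set R)
  let x0 : Z := ⟨⟨P, ‹_›⟩, hmem P ‹_› le_rfl⟩
  let x1 : Z := ⟨⟨P ⊔ Ideal.span {a}, hPa⟩, hmem _ hPa le_sup_left⟩
  let x2 : Z := ⟨⟨Q, hQprime⟩, hmem Q hQprime hPQ⟩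
  let x3 : Z := ⟨⟨maximalIdeal R, inferInstance⟩, hmem _ inferInstance (hPQ.trans hQle)⟩
  have lt01 : x0 < x1 := h01
  have lt12 : x1 < x2 := h12
  have lt23 : x2 < x3 := h23
  let p0 : LTSeries Z := RelSeries.singleton _ x0
  let p1 : LTSeries Z := p0.snoc x1 (by simpa [p0] using lt01)
  let p2 : LTSeries Z := p1.snoc x2 (by simpa [p1] using lt12)
  let p3 : LTSeries Z := p2.snoc x3 (by simpa [p2] using lt23)
  have hlen : p3.length = 3 := by simp [p3, p2, p1, p0]
  have h3 : (3 : WithBot ℕ∞) ≤ ringKrullDim (R ⧸ P) := by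
    rw [ringKrullDim_quotient]
    have := Order.LTSeries.length_le_krullDim p3
    rw [hlen] at this
    exact_mod_cast this
  rw [hP] at h3
  have h32 : (3 : ℕ∞) ≤ 2 := by exact_mod_cast h3
  exact absurd h32 (by norm_num)

/-- Nakayama step.  If `R ⧸ (a, b)` is a regular local ring of dimension `2` and both `a` and `b`
lie in `𝔪² ⊔ P`, then the maximal ideal of `R ⧸ P` is generated by two elements; if moreover
`dim R ⧸ P = 2`, the local ring `R ⧸ P` is regular. -/
theorem isRegularLocalRing_quotient_of_pair_mem_sq_sup [IsLocalRing R] [IsNoetherianRing R]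
    {P : Ideal R} [P.IsPrime] (hP : ringKrullDim (R ⧸ P) = 2) {a b : R}
    (hB : IsRegularLocalRing (R ⧸ Ideal.span {a, b}))
    (hdimB : ringKrullDim (R ⧸ Ideal.span {a, b}) = 2)
    (ha2 : a ∈ (maximalIdeal R) ^ 2 ⊔ P) (hb2 : b ∈ (maximalIdeal R) ^ 2 ⊔ P) :
    IsRegularLocalRing (R ⧸ P) := by
  classical
  haveI : Nontrivial (R ⧸ P) := Ideal.Quotient.nontrivial_iff.mpr Ideal.IsPrime.ne_top'
  haveI : IsLocalRing (R ⧸ P) := .of_surjective' _ Ideal.Quotient.mk_surjective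
  set I : Ideal R := Ideal.span {a, b} with hI
  -- two generators of the maximal ideal of `R ⧸ I`
  have hfr : (maximalIdeal (R ⧸ I)).spanFinrank = 2 := by
    have h := hB.spanFinrank_maximalIdeal
    rw [hdimB] at h
    exact_mod_cast h
  obtain ⟨s, hscard, hsspan⟩ :=
    Submodule.FG.exists_span_finset_card_eq_spanFinrank
      (IsNoetherian.noetherian (maximalIdeal (R ⧸ I)))
  -- lift them to `R`
  let g : R ⧸ I → R := fun y => (Ideal.Quotient.mk_surjective y).choose
  have hg : ∀ y, Ideal.Quotient.mk I (g y) = y := fun y =>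
    (Ideal.Quotient.mk_surjective y).choose_spec
  let N : Ideal R := Ideal.span (g '' (s : Set (R ⧸ I)))
  have hNmap : N.map (Ideal.Quotient.mk I) = maximalIdeal (R ⧸ I) := by
    rw [Ideal.map_span, Set.image_image]
    simp only [hg, Set.image_id']
    exact hsspan
  have hmN : maximalIdeal R ≤ N ⊔ I := by
    have h1 : maximalIdeal R ≤
        ((maximalIdeal R).map (Ideal.Quotient.mk I)).comap (Ideal.Quotient.mk I) :=
      Ideal.le_comap_map
    rw [IsLocalRing.map_maximalIdeal_of_surjective _ Ideal.Quotient.mk_surjective, ← hNmap,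
      Ideal.comap_map_of_surjective _ Ideal.Quotient.mk_surjective] at h1
    refine h1.trans (sup_le_sup_left ?_ _)
    rw [← RingHom.ker_eq_comap_bot, Ideal.mk_ker]
  have hNle : N ≤ maximalIdeal R := by
    rw [Ideal.span_le]
    rintro _ ⟨y, hy, rfl⟩
    have hy' : y ∈ maximalIdeal (R ⧸ I) := by
      rw [← hsspan]
      exact Submodule.subset_span hy
    by_contra hgy
    have hu : IsUnit (g y) := by
      simpa [IsLocalRing.mem_maximalIdeal, mem_nonunits_iff] using hgy
    have hyu : IsUnit y := by
      rw [← hg y]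
      exact hu.map _
    exact ((IsLocalRing.mem_maximalIdeal _).mp hy') hyu
  -- push everything to `R ⧸ P`
  have hIle : I.map (Ideal.Quotient.mk P) ≤ (maximalIdeal (R ⧸ P)) ^ 2 := by
    have : I ≤ (maximalIdeal R) ^ 2 ⊔ P := by
      rw [hI, Ideal.span_le]
      rintro x (rfl | rfl) <;> assumption
    refine (Ideal.map_mono this).trans ?_
    rw [Ideal.map_sup, Ideal.map_pow,
      IsLocalRing.map_maximalIdeal_of_surjective _ Ideal.Quotient.mk_surjective,
      Ideal.map_quotient_self, sup_bot_eq]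
  have hmA : maximalIdeal (R ⧸ P) ≤
      N.map (Ideal.Quotient.mk P) ⊔ maximalIdeal (R ⧸ P) • maximalIdeal (R ⧸ P) := by
    have h := Ideal.map_mono (f := Ideal.Quotient.mk P) hmN
    rw [IsLocalRing.map_maximalIdeal_of_surjective _ Ideal.Quotient.mk_surjective,
      Ideal.map_sup] at h
    refine h.trans (sup_le_sup_left ?_ _)
    rw [smul_eq_mul, ← pow_two]
    exact hIle
  have hNA : N.map (Ideal.Quotient.mk P) ≤ maximalIdeal (R ⧸ P) := by
    rw [← IsLocalRing.map_maximalIdeal_of_surjective (Ideal.Quotient.mk P)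
      Ideal.Quotient.mk_surjective]
    exact Ideal.map_mono hNle
  have heq : maximalIdeal (R ⧸ P) = N.map (Ideal.Quotient.mk P) := by
    refine le_antisymm ?_ hNA
    refine Submodule.le_of_le_smul_of_le_jacobson_bot (IsNoetherian.noetherian _) ?_ hmA
    rw [IsLocalRing.jacobson_eq_maximalIdeal ⊥ bot_ne_top]
  -- count generators
  have hfin : (maximalIdeal (R ⧸ P)).spanFinrank ≤ 2 := by
    rw [heq]
    refine (Ideal.spanFinrank_map_le_of_fg _ (IsNoetherian.noetherian N)).trans ?_
    refine (Submodule.spanFinrank_span_le_ncard_of_finite (s.finite_toSet.image g)).trans ?_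
    rw [← hfr, ← hscard]
    exact (Set.ncard_image_le s.finite_toSet).trans_eq (Set.ncard_coe_finset s)
  refine IsRegularLocalRing.of_spanFinrank_maximalIdeal_le _ ?_
  rw [hP]
  exact_mod_cast hfin

/-- **Inertia of fat touches** (ring form, sharpened hypotheses).  Let `R` be a Noetherian
local ring of dimension `4`, `P` a prime with `dim R ⧸ P = 2` and `R ⧸ P` not regular, such
that `P ⊔ (x)` is prime for every `x ∈ 𝔪 ∖ (𝔪² ⊔ P)` (anisotropy of the tangent cone,
clause (a)).  Let `ϖ ∈ P`, and let `a, b ∈ 𝔪` be such that `R ⧸ (a, b)` is regular of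
dimension `2` and `P ≤ √(a, b, ϖ)` (E1).  Then the image of `(a, b)` in `R ⧸ P` is a principal
ideal. -/
theorem exists_map_span_pair_eq_span_singleton [IsLocalRing R] [IsNoetherianRing R]
    (hR : ringKrullDim R = 4) {P : Ideal R} [P.IsPrime] (hP : ringKrullDim (R ⧸ P) = 2)
    (hA : ¬ IsRegularLocalRing (R ⧸ P))
    (hAniso : ∀ x : R, x ∈ maximalIdeal R → x ∉ (maximalIdeal R) ^ 2 ⊔ P →
      (P ⊔ Ideal.span {x}).IsPrime)
    {ϖ a b : R} (hϖP : ϖ ∈ P) (ha : a ∈ maximalIdeal R) (hb : b ∈ maximalIdeal R)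
    (hB : IsRegularLocalRing (R ⧸ Ideal.span {a, b}))
    (hdimB : ringKrullDim (R ⧸ Ideal.span {a, b}) = 2)
    (hE1 : P ≤ (Ideal.span {a, b, ϖ}).radical) :
    ∃ c : R ⧸ P, (Ideal.span {a, b}).map (Ideal.Quotient.mk P) = Ideal.span {c} := by
  have hϖ : ϖ ∈ maximalIdeal R := IsLocalRing.le_maximalIdeal Ideal.IsPrime.ne_top' hϖP
  -- the asymmetric core: `a ∉ 𝔪² ⊔ P`
  have core : ∀ {a b : R}, a ∈ maximalIdeal R → b ∈ maximalIdeal R →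
      a ∉ (maximalIdeal R) ^ 2 ⊔ P → P ≤ (Ideal.span {a, b, ϖ}).radical →
      ∃ c : R ⧸ P, (Ideal.span {a, b}).map (Ideal.Quotient.mk P) = Ideal.span {c} := by
    intro a b ha hb ha2 hE1
    have hPa : (P ⊔ Ideal.span {a}).IsPrime := hAniso a ha ha2
    have haP : a ∉ P := fun h => ha2 (Ideal.mem_sup_right h)
    have hbmem : b ∈ P ⊔ Ideal.span {a} :=
      mem_sup_span_singleton_of_radical_le hR hP ha hb haP hPa hϖ hE1
    refine ⟨Ideal.Quotient.mk P a, ?_⟩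
    have hb' : Ideal.Quotient.mk P b ∈ Ideal.span {Ideal.Quotient.mk P a} := by
      have := Ideal.mem_map_of_mem (Ideal.Quotient.mk P) hbmem
      rwa [Ideal.map_sup, Ideal.map_quotient_self, bot_sup_eq, Ideal.map_span,
        Set.image_singleton] at this
    rw [Ideal.map_span, Set.image_pair, Set.pair_comm]
    exact Submodule.span_insert_eq_span hb'
  by_cases ha2 : a ∈ (maximalIdeal R) ^ 2 ⊔ P
  · by_cases hb2 : b ∈ (maximalIdeal R) ^ 2 ⊔ P
    · exact absurd (isRegularLocalRing_quotient_of_pair_mem_sq_sup hP hB hdimB ha2 hb2) hA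
    · have hB' : IsRegularLocalRing (R ⧸ Ideal.span {b, a}) := by rwa [Set.pair_comm]
      have hdimB' : ringKrullDim (R ⧸ Ideal.span {b, a}) = 2 := by rwa [Set.pair_comm]
      have hE1' : P ≤ (Ideal.span {b, a, ϖ}).radical := by rwa [Set.insert_comm]
      obtain ⟨c, hc⟩ := core hb ha hb2 hE1'
      exact ⟨c, by rwa [Set.pair_comm] at hc⟩
  · exact core ha hb ha2 hE1

/-- **`FatTouchInert`** with the strategist's full binder list (res-L1-w45b-strat-1,
`Sketch-aniso.lean`, definitions `TangentConeAnisotropic` / `FatTouchInert` unfolded): for `R`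
regular local of dimension `4`, `P` prime with `dim R ⧸ P = 2` and `R ⧸ P` not regular, a
regular parameter `t ∈ P ∖ 𝔪²`, an anisotropic tangent cone (clauses (a) and (b)), `ϖ ∈ P` with
`ϖ ∉ (a, b)`, `a, b ∈ 𝔪` with `R ⧸ (a, b)` regular of dimension `2`, and `P ≤ √(a, b, ϖ)`, the
trace `(ā, b̄) ⊂ R ⧸ P` is principal.  The hypotheses `t`, clause (b), regularity of `R` and
`ϖ ∉ (a, b)` are not used (see `exists_map_span_pair_eq_span_singleton`). -/
theorem fatTouchInert (R : Type*) [CommRing R] [IsLocalRing R] [IsNoetherianRing R]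
    (_hreg : IsRegularLocalRing R) (hR : ringKrullDim R = 4)
    (P : Ideal R) (hPp : P.IsPrime) (ϖ a b t : R)
    (hP : ringKrullDim (R ⧸ P) = 2) (hA : ¬ IsRegularLocalRing (R ⧸ P))
    (_ht : t ∈ P) (_ht2 : t ∉ (maximalIdeal R) ^ 2)
    (hAniso :
      (∀ x : R, x ∈ maximalIdeal R → x ∉ (maximalIdeal R) ^ 2 ⊔ P →
        (P ⊔ Ideal.span {x}).IsPrime) ∧
      (∀ x y : R, x ∈ maximalIdeal R → y ∈ maximalIdeal R →
        ¬ (IsRegularLocalRing (R ⧸ (P ⊔ Ideal.span {x, y})) ∧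
           ringKrullDim (R ⧸ (P ⊔ Ideal.span {x, y})) = 1)))
    (hϖP : ϖ ∈ P) (_hϖab : ϖ ∉ Ideal.span {a, b})
    (ha : a ∈ maximalIdeal R) (hb : b ∈ maximalIdeal R)
    (hB : IsRegularLocalRing (R ⧸ Ideal.span {a, b}))
    (hdimB : ringKrullDim (R ⧸ Ideal.span {a, b}) = 2)
    (hE1 : P ≤ (Ideal.span {a, b, ϖ}).radical) :
    ∃ c : R ⧸ P, Ideal.map (Ideal.Quotient.mk P) (Ideal.span {a, b}) = Ideal.span {c} :=
  haveI := hPp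
  exists_map_span_pair_eq_span_singleton hR hP hA hAniso.1 hϖP ha hb hB hdimB hE1

end Summit.ResolutionOfSingularities.ResolutionOfSingularities.Cruxes.EquisingularLiftNat.AnisoInertia
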